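import Literature.RepresentationTheory.KonnoKonno2007.RealUnitaryRankOneKAKDescent
import Literature.NumberTheory.Automorphic.InfUnitaryOneParameterGroupDeriv
import Literature.NumberTheory.Automorphic.UnitaryGlobalizationRecognition
import Literature.NumberTheory.Automorphic.UpqGlobalizationTorusLawDeriv
import HarnessLib

/-!
# The unitary globalization of an infinitesimally unitary `(𝔤, K)`-module of `U(α,β)` (`|β| = 1`) from the torus translation law:
# group law, `ContRepresentation`, `K`-compatibility, the differential on `𝔨 ∪ 𝔭`, and recognition

Topic `NumberTheory/Automorphic`; namespace `Literature.NumberTheory.Automorphic.IsPosDefHerm` (sequel of ★ Φ1 `RealUnitaryRankOneKAKDescent` (`globOp`), ★ P2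
`InfUnitaryOneParameterGroupDeriv` (`hB.U`, (U1)–(U7)), ★ H `UnitaryGlobalizationRecognition` (A-p03 (g22))).  ONE honest DEFINITION (`globRep`, the
`ContRepresentation` packaging `globOp` once the group law is known) + theorems; no instance, no notation, no named fact, no `sorry`.  Cell `hodgecm-mathlib`,
F0∕P3, in-house road to the letter A6 `HasUnitaryGlobalizationOfInfUnitary` at `U(2,1)` (ROAD-GLOB v1.1, brick Φ3, T1a LEAD F0P3b-p01 (g3)).

THE MATHEMATICS ([HarishChandra1953, §9]; [KnappVogan1995, Introduction Thm. 0.6]; [Knapp2002, Thm. 7.39]).  Let `Φ = globOp p₀ q₀ ϖK U₀`, `ϖK = hB.kRep ρK`,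
`U₀ = hB.U ρ K H₀` (`H₀ = upqUnit (p₀,q₀) (−i)`), and ASSUME the torus translation law `Φ(g a_s) = Φ(g) U₀(s)` (bricks Φ2-core∕diff∕geom).  Then:
§1 `Φ(gh) = Φ(g) Φ(h)` (`h = k₁ a_t k₂`, right `K`-covariance of ★ Φ1); §2 `globRep : ContRepresentation ℂ G.carrier E` — unitary, strongly continuous; §3
`globRep (k) ι v = ι (ρ_K k v)`; §4 the differential on `ι V`: along `𝔨` (★ `hasDerivAt_emb_expK`) and along hermitian `X ∈ 𝔭` (`X = Ad(k)(c H₀)` by ★ S1a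
`exists_Ad_smul_boostUnit_eq_of_isHermitian`, `exp(sX) = k a_{sc} k⁻¹`, (U4)); §5 for `(V, ρ_K, ρ) = r` an admissible irreducible `(𝔤,K)`-module and `𝔨 ∪ 𝔭`
spanning `𝔤`, ★ H `isUnitaryGlobalization_of_recognition` gives `IsUnitaryGlobalization G [r] globRep`, hence `HasUnitaryGlobalization G [r]`.

## Mathlib ∕ tree search
Tree: ★ `globOp_kakMap`∕`_kV`∕`_hypV`∕`_one`∕`_mul_kV`∕`_mem_unitary`∕`continuous_globOp_apply` (Φ1), ★ `kRep_emb`, `hasDerivAt_U_emb`, `U_zero`, `hasDerivAt_emb_expK`,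
`kakMap_surjective`, `kV_upqKBlock`, `upq_kV_mem_maximalCompact`, ★ S1a `exists_Ad_smul_boostUnit_eq_of_isHermitian`, `expMem_smul_boostUnit`, ★
`RealMatrixGroup.expMem_Ad`, ★ `isUnitaryGlobalization_of_recognition`.  Dedup: `rg "globRep" Literature/` — none.

## References
* Harish-Chandra, *Representations of a semisimple Lie group on a Banach space. I*, Trans. AMS 75 (1953), §9 [HarishChandra1953].
* A. W. Knapp, D. A. Vogan, *Cohomological Induction and Unitary Representations* (1995), Introduction Thm. 0.6 [KnappVogan1995].
* A. W. Knapp, *Lie Groups Beyond an Introduction*, 2nd ed. (2002), Thm. 7.39 [Knapp2002].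
-/

set_option autoImplicit false

noncomputable section

attribute [local instance 100] LieRing.ofAssociativeRing

open Finset Set Filter Complex
open scoped Nat InnerProductSpace ComplexConjugate Matrix.Norms.Operator Topology MatrixGroups Matrix

namespace Literature.NumberTheory.Automorphic

namespace IsPosDefHerm

open Literature.RepresentationTheory.KonnoKonno2007 Literature.RepresentationTheory.KonnoKonno2007.RealDualPair
open Literature.RepresentationTheory.KonnoKonno2007.RealDualPair.UForm Literature.RepresentationTheory.BorelWallach2000

universe u

variable {α β : Type} [Fintype α] [DecidableEq α] [Fintype β] [DecidableEq β] [Subsingleton β] (p₀ : α) (q₀ : β)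
  {V : Type} [AddCommGroup V] [Module ℂ V] {B : V →ₗ⋆[ℂ] V →ₗ[ℂ] ℂ} (hB : IsPosDefHerm B)
include hB

variable {ρK : Representation ℂ (uFormGroup α β).maximalCompact V} {ρ : (uFormGroup α β).lie →ₗ⁅ℝ⁆ Module.End ℂ V}
variable {hinv : ∀ (k : (uFormGroup α β).maximalCompact) (x y : V), B (ρK k x) (ρK k y) = B x y} {K : ℝ}

/-! ## §1 The group law from the torus translation law -/

/-- **Group law**: if `Φ = globOp` satisfies the torus translation law `Φ(g a_s) = Φ(g) ∘ U₀(s)`, then `Φ(gh) = Φ(g) ∘ Φ(h)` (write `h = k₁ a_t k₂` and use the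
right `K`-covariance of ★ Φ1). [cite: Knapp2002, Thm. 7.39] [cite: HarishChandra1953, §9] -/
theorem globOp_mul
    (hU0 : hB.U ρ K (upqUnit (p₀, q₀) (-I)) 0 = 1)
    (hM : ∀ (m : KV α β) (t : ℝ), 0 < t →
      (((kV α β m : UForm α β) : GL (α ⊕ β) ℂ) : Matrix (α ⊕ β) (α ⊕ β) ℂ) *
          ((upqUnit (p₀, q₀) (-I) : (uFormGroup α β).lie) : Matrix (α ⊕ β) (α ⊕ β) ℂ) =
        ((upqUnit (p₀, q₀) (-I) : (uFormGroup α β).lie) : Matrix (α ⊕ β) (α ⊕ β) ℂ) *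
          (((kV α β m : UForm α β) : GL (α ⊕ β) ℂ) : Matrix (α ⊕ β) (α ⊕ β) ℂ) →
      hB.kRep ρK hinv (upqMaximalCompactEquiv.symm m) ∘L hB.U ρ K (upqUnit (p₀, q₀) (-I)) t =
        hB.U ρ K (upqUnit (p₀, q₀) (-I)) t ∘L hB.kRep ρK hinv (upqMaximalCompactEquiv.symm m))
    (hW : ∀ t : ℝ, hB.kRep ρK hinv (upqMaximalCompactEquiv.symm (weylKV p₀ : KV α β)) ∘L hB.U ρ K (upqUnit (p₀, q₀) (-I)) t =
      hB.U ρ K (upqUnit (p₀, q₀) (-I)) (-t) ∘L hB.kRep ρK hinv (upqMaximalCompactEquiv.symm (weylKV p₀ : KV α β)))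
    (htorus : ∀ (g : UForm α β) (s : ℝ),
      globOp p₀ q₀ (hB.kRep ρK hinv) (hB.U ρ K (upqUnit (p₀, q₀) (-I))) (g * hypV p₀ q₀ s) =
        globOp p₀ q₀ (hB.kRep ρK hinv) (hB.U ρ K (upqUnit (p₀, q₀) (-I))) g ∘L hB.U ρ K (upqUnit (p₀, q₀) (-I)) s)
    (g h : UForm α β) :
    globOp p₀ q₀ (hB.kRep ρK hinv) (hB.U ρ K (upqUnit (p₀, q₀) (-I))) (g * h) =
      globOp p₀ q₀ (hB.kRep ρK hinv) (hB.U ρ K (upqUnit (p₀, q₀) (-I))) g ∘L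
        globOp p₀ q₀ (hB.kRep ρK hinv) (hB.U ρ K (upqUnit (p₀, q₀) (-I))) h := by
  obtain ⟨⟨k₁, t, k₂⟩, rfl⟩ := kakMap_surjective p₀ q₀ h
  have h1 : g * kakMap p₀ q₀ (k₁, t, k₂) = g * kV α β k₁ * hypV p₀ q₀ t * kV α β k₂ := by
    rw [kakMap_apply]; simp only [mul_assoc]
  rw [h1, globOp_mul_kV p₀ q₀ hU0 hM hW, htorus, globOp_mul_kV p₀ q₀ hU0 hM hW, globOp_kakMap p₀ q₀ hU0 hM hW k₁ t k₂]
  -- reassociate (pointwise `rfl`; `simp only [comp_assoc]` is too expensive for the kernel on the concrete completion)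
  exact ContinuousLinearMap.ext fun x => rfl

/-! ## §2 The representation `globRep` -/

/-- **The unitary globalization as a `ContRepresentation`**: `globOp` with the group law. [cite: KnappVogan1995, Introduction Thm. 0.6] [cite: HarishChandra1953, §9] -/
def globRep
    (hU0 : hB.U ρ K (upqUnit (p₀, q₀) (-I)) 0 = 1)
    (hM : ∀ (m : KV α β) (t : ℝ), 0 < t →
      (((kV α β m : UForm α β) : GL (α ⊕ β) ℂ) : Matrix (α ⊕ β) (α ⊕ β) ℂ) *
          ((upqUnit (p₀, q₀) (-I) : (uFormGroup α β).lie) : Matrix (α ⊕ β) (α ⊕ β) ℂ) =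
        ((upqUnit (p₀, q₀) (-I) : (uFormGroup α β).lie) : Matrix (α ⊕ β) (α ⊕ β) ℂ) *
          (((kV α β m : UForm α β) : GL (α ⊕ β) ℂ) : Matrix (α ⊕ β) (α ⊕ β) ℂ) →
      hB.kRep ρK hinv (upqMaximalCompactEquiv.symm m) ∘L hB.U ρ K (upqUnit (p₀, q₀) (-I)) t =
        hB.U ρ K (upqUnit (p₀, q₀) (-I)) t ∘L hB.kRep ρK hinv (upqMaximalCompactEquiv.symm m))
    (hW : ∀ t : ℝ, hB.kRep ρK hinv (upqMaximalCompactEquiv.symm (weylKV p₀ : KV α β)) ∘L hB.U ρ K (upqUnit (p₀, q₀) (-I)) t =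
      hB.U ρ K (upqUnit (p₀, q₀) (-I)) (-t) ∘L hB.kRep ρK hinv (upqMaximalCompactEquiv.symm (weylKV p₀ : KV α β)))
    (htorus : ∀ (g : UForm α β) (s : ℝ),
      globOp p₀ q₀ (hB.kRep ρK hinv) (hB.U ρ K (upqUnit (p₀, q₀) (-I))) (g * hypV p₀ q₀ s) =
        globOp p₀ q₀ (hB.kRep ρK hinv) (hB.U ρ K (upqUnit (p₀, q₀) (-I))) g ∘L hB.U ρ K (upqUnit (p₀, q₀) (-I)) s) :
    ContRepresentation ℂ (uFormGroup α β).carrier hB.E :=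
  ContRepresentation.ofMonoidHom
    { toFun := fun g => globOp p₀ q₀ (hB.kRep ρK hinv) (hB.U ρ K (upqUnit (p₀, q₀) (-I))) g
      map_one' := globOp_one p₀ q₀ hU0 hM hW
      map_mul' := fun g h => by
        rw [ContinuousLinearMap.mul_def]
        exact hB.globOp_mul p₀ q₀ hU0 hM hW htorus g h }

/-- `globRep g = globOp g`. [cite: KnappVogan1995, Introduction Thm. 0.6] -/
theorem globRep_apply
    (hU0 : hB.U ρ K (upqUnit (p₀, q₀) (-I)) 0 = 1)
    (hM : ∀ (m : KV α β) (t : ℝ), 0 < t →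
      (((kV α β m : UForm α β) : GL (α ⊕ β) ℂ) : Matrix (α ⊕ β) (α ⊕ β) ℂ) *
          ((upqUnit (p₀, q₀) (-I) : (uFormGroup α β).lie) : Matrix (α ⊕ β) (α ⊕ β) ℂ) =
        ((upqUnit (p₀, q₀) (-I) : (uFormGroup α β).lie) : Matrix (α ⊕ β) (α ⊕ β) ℂ) *
          (((kV α β m : UForm α β) : GL (α ⊕ β) ℂ) : Matrix (α ⊕ β) (α ⊕ β) ℂ) →
      hB.kRep ρK hinv (upqMaximalCompactEquiv.symm m) ∘L hB.U ρ K (upqUnit (p₀, q₀) (-I)) t =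
        hB.U ρ K (upqUnit (p₀, q₀) (-I)) t ∘L hB.kRep ρK hinv (upqMaximalCompactEquiv.symm m))
    (hW : ∀ t : ℝ, hB.kRep ρK hinv (upqMaximalCompactEquiv.symm (weylKV p₀ : KV α β)) ∘L hB.U ρ K (upqUnit (p₀, q₀) (-I)) t =
      hB.U ρ K (upqUnit (p₀, q₀) (-I)) (-t) ∘L hB.kRep ρK hinv (upqMaximalCompactEquiv.symm (weylKV p₀ : KV α β)))
    (htorus : ∀ (g : UForm α β) (s : ℝ),
      globOp p₀ q₀ (hB.kRep ρK hinv) (hB.U ρ K (upqUnit (p₀, q₀) (-I))) (g * hypV p₀ q₀ s) =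
        globOp p₀ q₀ (hB.kRep ρK hinv) (hB.U ρ K (upqUnit (p₀, q₀) (-I))) g ∘L hB.U ρ K (upqUnit (p₀, q₀) (-I)) s)
    (g : (uFormGroup α β).carrier) :
    hB.globRep p₀ q₀ hU0 hM hW htorus g = globOp p₀ q₀ (hB.kRep ρK hinv) (hB.U ρ K (upqUnit (p₀, q₀) (-I))) g := rfl


/-! ## §3 `K`-compatibility, unitarity, strong continuity -/

omit [Subsingleton β] [AddCommGroup V] [Module ℂ V] hB in
/-- `k ∈ K`, read in `U(α,β)`, is `kV (e k)` (`e = upqMaximalCompactEquiv`). [cite: KonnoKonno2007, §3.1] -/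
theorem inclusion_eq_kV (k : (uFormGroup α β).maximalCompact) :
    (Subgroup.inclusion (uFormGroup α β).maximalCompact_le_carrier k : UForm α β) = kV α β (upqMaximalCompactEquiv k) :=
  Subtype.ext (kV_upqKBlock k).symm

/-- **`globRep` extends `ϖK` on `K`**: `globRep (k) = hB.kRep ρK k`. [cite: KnappVogan1995, Introduction Thm. 0.6] -/
theorem globRep_inclusion
    (hU0 : hB.U ρ K (upqUnit (p₀, q₀) (-I)) 0 = 1)
    (hM : ∀ (m : KV α β) (t : ℝ), 0 < t →
      (((kV α β m : UForm α β) : GL (α ⊕ β) ℂ) : Matrix (α ⊕ β) (α ⊕ β) ℂ) *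
          ((upqUnit (p₀, q₀) (-I) : (uFormGroup α β).lie) : Matrix (α ⊕ β) (α ⊕ β) ℂ) =
        ((upqUnit (p₀, q₀) (-I) : (uFormGroup α β).lie) : Matrix (α ⊕ β) (α ⊕ β) ℂ) *
          (((kV α β m : UForm α β) : GL (α ⊕ β) ℂ) : Matrix (α ⊕ β) (α ⊕ β) ℂ) →
      hB.kRep ρK hinv (upqMaximalCompactEquiv.symm m) ∘L hB.U ρ K (upqUnit (p₀, q₀) (-I)) t =
        hB.U ρ K (upqUnit (p₀, q₀) (-I)) t ∘L hB.kRep ρK hinv (upqMaximalCompactEquiv.symm m))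
    (hW : ∀ t : ℝ, hB.kRep ρK hinv (upqMaximalCompactEquiv.symm (weylKV p₀ : KV α β)) ∘L hB.U ρ K (upqUnit (p₀, q₀) (-I)) t =
      hB.U ρ K (upqUnit (p₀, q₀) (-I)) (-t) ∘L hB.kRep ρK hinv (upqMaximalCompactEquiv.symm (weylKV p₀ : KV α β)))
    (htorus : ∀ (g : UForm α β) (s : ℝ),
      globOp p₀ q₀ (hB.kRep ρK hinv) (hB.U ρ K (upqUnit (p₀, q₀) (-I))) (g * hypV p₀ q₀ s) =
        globOp p₀ q₀ (hB.kRep ρK hinv) (hB.U ρ K (upqUnit (p₀, q₀) (-I))) g ∘L hB.U ρ K (upqUnit (p₀, q₀) (-I)) s)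
    (k : (uFormGroup α β).maximalCompact) :
    hB.globRep p₀ q₀ hU0 hM hW htorus (Subgroup.inclusion (uFormGroup α β).maximalCompact_le_carrier k) = hB.kRep ρK hinv k := by
  rw [globRep_apply]
  change globOp p₀ q₀ (hB.kRep ρK hinv) (hB.U ρ K (upqUnit (p₀, q₀) (-I)))
    (Subgroup.inclusion (uFormGroup α β).maximalCompact_le_carrier k : UForm α β) = _
  rw [inclusion_eq_kV k, globOp_kV p₀ q₀ hU0 hM hW, ContinuousMulEquiv.symm_apply_apply]

/-- **`K`-compatibility on `ι V`**: `globRep (k) (ι v) = ι (ρ_K k v)`. [cite: KnappVogan1995, Introduction Thm. 0.6] -/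
theorem globRep_inclusion_emb
    (hU0 : hB.U ρ K (upqUnit (p₀, q₀) (-I)) 0 = 1)
    (hM : ∀ (m : KV α β) (t : ℝ), 0 < t →
      (((kV α β m : UForm α β) : GL (α ⊕ β) ℂ) : Matrix (α ⊕ β) (α ⊕ β) ℂ) *
          ((upqUnit (p₀, q₀) (-I) : (uFormGroup α β).lie) : Matrix (α ⊕ β) (α ⊕ β) ℂ) =
        ((upqUnit (p₀, q₀) (-I) : (uFormGroup α β).lie) : Matrix (α ⊕ β) (α ⊕ β) ℂ) *
          (((kV α β m : UForm α β) : GL (α ⊕ β) ℂ) : Matrix (α ⊕ β) (α ⊕ β) ℂ) →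
      hB.kRep ρK hinv (upqMaximalCompactEquiv.symm m) ∘L hB.U ρ K (upqUnit (p₀, q₀) (-I)) t =
        hB.U ρ K (upqUnit (p₀, q₀) (-I)) t ∘L hB.kRep ρK hinv (upqMaximalCompactEquiv.symm m))
    (hW : ∀ t : ℝ, hB.kRep ρK hinv (upqMaximalCompactEquiv.symm (weylKV p₀ : KV α β)) ∘L hB.U ρ K (upqUnit (p₀, q₀) (-I)) t =
      hB.U ρ K (upqUnit (p₀, q₀) (-I)) (-t) ∘L hB.kRep ρK hinv (upqMaximalCompactEquiv.symm (weylKV p₀ : KV α β)))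
    (htorus : ∀ (g : UForm α β) (s : ℝ),
      globOp p₀ q₀ (hB.kRep ρK hinv) (hB.U ρ K (upqUnit (p₀, q₀) (-I))) (g * hypV p₀ q₀ s) =
        globOp p₀ q₀ (hB.kRep ρK hinv) (hB.U ρ K (upqUnit (p₀, q₀) (-I))) g ∘L hB.U ρ K (upqUnit (p₀, q₀) (-I)) s)
    (k : (uFormGroup α β).maximalCompact) (v : V) :
    hB.globRep p₀ q₀ hU0 hM hW htorus (Subgroup.inclusion (uFormGroup α β).maximalCompact_le_carrier k) (hB.emb v) = hB.emb (ρK k v) := by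
  rw [hB.globRep_inclusion p₀ q₀ hU0 hM hW htorus, hB.kRep_emb]

/-- **`globRep` is unitary** (★ Φ1 `globOp_mem_unitary`, ★ `kRep_mem_unitary`, ★ (U2)). [cite: KnappVogan1995, Introduction Thm. 0.6] -/
theorem isUnitary_globRep
    (hU0 : hB.U ρ K (upqUnit (p₀, q₀) (-I)) 0 = 1)
    (hM : ∀ (m : KV α β) (t : ℝ), 0 < t →
      (((kV α β m : UForm α β) : GL (α ⊕ β) ℂ) : Matrix (α ⊕ β) (α ⊕ β) ℂ) *
          ((upqUnit (p₀, q₀) (-I) : (uFormGroup α β).lie) : Matrix (α ⊕ β) (α ⊕ β) ℂ) =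
        ((upqUnit (p₀, q₀) (-I) : (uFormGroup α β).lie) : Matrix (α ⊕ β) (α ⊕ β) ℂ) *
          (((kV α β m : UForm α β) : GL (α ⊕ β) ℂ) : Matrix (α ⊕ β) (α ⊕ β) ℂ) →
      hB.kRep ρK hinv (upqMaximalCompactEquiv.symm m) ∘L hB.U ρ K (upqUnit (p₀, q₀) (-I)) t =
        hB.U ρ K (upqUnit (p₀, q₀) (-I)) t ∘L hB.kRep ρK hinv (upqMaximalCompactEquiv.symm m))
    (hW : ∀ t : ℝ, hB.kRep ρK hinv (upqMaximalCompactEquiv.symm (weylKV p₀ : KV α β)) ∘L hB.U ρ K (upqUnit (p₀, q₀) (-I)) t =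
      hB.U ρ K (upqUnit (p₀, q₀) (-I)) (-t) ∘L hB.kRep ρK hinv (upqMaximalCompactEquiv.symm (weylKV p₀ : KV α β)))
    (htorus : ∀ (g : UForm α β) (s : ℝ),
      globOp p₀ q₀ (hB.kRep ρK hinv) (hB.U ρ K (upqUnit (p₀, q₀) (-I))) (g * hypV p₀ q₀ s) =
        globOp p₀ q₀ (hB.kRep ρK hinv) (hB.U ρ K (upqUnit (p₀, q₀) (-I))) g ∘L hB.U ρ K (upqUnit (p₀, q₀) (-I)) s)
    (hK : 0 ≤ K) (hX : ∀ x y, B (ρ (upqUnit (p₀, q₀) (-I)) x) y = -B x (ρ (upqUnit (p₀, q₀) (-I)) y))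
    (hb : ∀ v : V, ∃ C : ℝ, ∀ n, ‖hB.emb (((ρ (upqUnit (p₀, q₀) (-I)) : V →ₗ[ℂ] V) ^ n) v)‖ ≤
      C * n ! * (K * ‖((upqUnit (p₀, q₀) (-I) : (uFormGroup α β).lie) : Matrix (α ⊕ β) (α ⊕ β) ℂ)‖) ^ n) :
    (hB.globRep p₀ q₀ hU0 hM hW htorus).IsUnitary := fun g =>
  globOp_mem_unitary p₀ q₀ hU0 hM hW (fun k => hB.kRep_mem_unitary ρK hinv k) (fun t => hB.U_mem_unitary hK hX hb t) g

/-- **`globRep` is strongly continuous** (★ Φ1 `continuous_globOp_apply`). [cite: KnappVogan1995, Introduction Thm. 0.6] -/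
theorem isStronglyContinuous_globRep
    (hU0 : hB.U ρ K (upqUnit (p₀, q₀) (-I)) 0 = 1)
    (hM : ∀ (m : KV α β) (t : ℝ), 0 < t →
      (((kV α β m : UForm α β) : GL (α ⊕ β) ℂ) : Matrix (α ⊕ β) (α ⊕ β) ℂ) *
          ((upqUnit (p₀, q₀) (-I) : (uFormGroup α β).lie) : Matrix (α ⊕ β) (α ⊕ β) ℂ) =
        ((upqUnit (p₀, q₀) (-I) : (uFormGroup α β).lie) : Matrix (α ⊕ β) (α ⊕ β) ℂ) *
          (((kV α β m : UForm α β) : GL (α ⊕ β) ℂ) : Matrix (α ⊕ β) (α ⊕ β) ℂ) →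
      hB.kRep ρK hinv (upqMaximalCompactEquiv.symm m) ∘L hB.U ρ K (upqUnit (p₀, q₀) (-I)) t =
        hB.U ρ K (upqUnit (p₀, q₀) (-I)) t ∘L hB.kRep ρK hinv (upqMaximalCompactEquiv.symm m))
    (hW : ∀ t : ℝ, hB.kRep ρK hinv (upqMaximalCompactEquiv.symm (weylKV p₀ : KV α β)) ∘L hB.U ρ K (upqUnit (p₀, q₀) (-I)) t =
      hB.U ρ K (upqUnit (p₀, q₀) (-I)) (-t) ∘L hB.kRep ρK hinv (upqMaximalCompactEquiv.symm (weylKV p₀ : KV α β)))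
    (htorus : ∀ (g : UForm α β) (s : ℝ),
      globOp p₀ q₀ (hB.kRep ρK hinv) (hB.U ρ K (upqUnit (p₀, q₀) (-I))) (g * hypV p₀ q₀ s) =
        globOp p₀ q₀ (hB.kRep ρK hinv) (hB.U ρ K (upqUnit (p₀, q₀) (-I))) g ∘L hB.U ρ K (upqUnit (p₀, q₀) (-I)) s)
    (hV : IsGKModule (uFormGroup α β) ρK ρ) (hK : 0 < K)
    (hX : ∀ x y, B (ρ (upqUnit (p₀, q₀) (-I)) x) y = -B x (ρ (upqUnit (p₀, q₀) (-I)) y))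
    (hb : ∀ v : V, ∃ C : ℝ, ∀ n, ‖hB.emb (((ρ (upqUnit (p₀, q₀) (-I)) : V →ₗ[ℂ] V) ^ n) v)‖ ≤
      C * n ! * (K * ‖((upqUnit (p₀, q₀) (-I) : (uFormGroup α β).lie) : Matrix (α ⊕ β) (α ⊕ β) ℂ)‖) ^ n) :
    (hB.globRep p₀ q₀ hU0 hM hW htorus).IsStronglyContinuous := fun x =>
  continuous_globOp_apply p₀ q₀ hU0 hM hW (fun k => hB.kRep_mem_unitary ρK hinv k) (fun t => hB.U_mem_unitary hK.le hX hb t)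
    (hB.isStronglyContinuous_kRep ρK hinv hV.kFinite hV.weaklyContinuous) (fun v => hB.continuous_U_apply hK hX hb v) x

/-! ## §4 The differential on `ι V`: along `𝔨` and along hermitian `X ∈ 𝔭` -/

omit [Subsingleton β] [AddCommGroup V] [Module ℂ V] hB in
/-- `exp (s Y) ∈ K` for `Y ∈ 𝔨`, as an element of `U(α,β)`: `expMem (s • Y) = inclusion (expK (s • Y))`. [cite: Knapp2002, I §10 Prop. 1.87] -/
theorem expMem_smul_inclusion_compactLie (Y : (uFormGroup α β).compactLie) (s : ℝ) :
    (uFormGroup α β).expMem (s • (LieSubalgebra.inclusion (uFormGroup α β).compactLie_le_lie Y : (uFormGroup α β).lie)) =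
      Subgroup.inclusion (uFormGroup α β).maximalCompact_le_carrier ((uFormGroup α β).expK (s • Y)) :=
  Subtype.ext (by rw [RealMatrixGroup.coe_expMem]; rfl)

/-- **The differential along `𝔨`**: `d/ds|₀ globRep (exp (s Y)) ι v = ι (ρ(Y) v)` for `Y ∈ 𝔨` (★ `hasDerivAt_emb_expK`). [cite: HarishChandra1953, §9] -/
theorem hasDerivAt_globRep_expMem_compactLie
    (hU0 : hB.U ρ K (upqUnit (p₀, q₀) (-I)) 0 = 1)
    (hM : ∀ (m : KV α β) (t : ℝ), 0 < t →
      (((kV α β m : UForm α β) : GL (α ⊕ β) ℂ) : Matrix (α ⊕ β) (α ⊕ β) ℂ) *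
          ((upqUnit (p₀, q₀) (-I) : (uFormGroup α β).lie) : Matrix (α ⊕ β) (α ⊕ β) ℂ) =
        ((upqUnit (p₀, q₀) (-I) : (uFormGroup α β).lie) : Matrix (α ⊕ β) (α ⊕ β) ℂ) *
          (((kV α β m : UForm α β) : GL (α ⊕ β) ℂ) : Matrix (α ⊕ β) (α ⊕ β) ℂ) →
      hB.kRep ρK hinv (upqMaximalCompactEquiv.symm m) ∘L hB.U ρ K (upqUnit (p₀, q₀) (-I)) t =
        hB.U ρ K (upqUnit (p₀, q₀) (-I)) t ∘L hB.kRep ρK hinv (upqMaximalCompactEquiv.symm m))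
    (hW : ∀ t : ℝ, hB.kRep ρK hinv (upqMaximalCompactEquiv.symm (weylKV p₀ : KV α β)) ∘L hB.U ρ K (upqUnit (p₀, q₀) (-I)) t =
      hB.U ρ K (upqUnit (p₀, q₀) (-I)) (-t) ∘L hB.kRep ρK hinv (upqMaximalCompactEquiv.symm (weylKV p₀ : KV α β)))
    (htorus : ∀ (g : UForm α β) (s : ℝ),
      globOp p₀ q₀ (hB.kRep ρK hinv) (hB.U ρ K (upqUnit (p₀, q₀) (-I))) (g * hypV p₀ q₀ s) =
        globOp p₀ q₀ (hB.kRep ρK hinv) (hB.U ρ K (upqUnit (p₀, q₀) (-I))) g ∘L hB.U ρ K (upqUnit (p₀, q₀) (-I)) s)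
    (hV : IsGKModule (uFormGroup α β) ρK ρ) (Y : (uFormGroup α β).compactLie) (v : V) :
    HasDerivAt (fun s : ℝ => hB.globRep p₀ q₀ hU0 hM hW htorus
        ((uFormGroup α β).expMem (s • (LieSubalgebra.inclusion (uFormGroup α β).compactLie_le_lie Y : (uFormGroup α β).lie))) (hB.emb v))
      (hB.emb (ρ (LieSubalgebra.inclusion (uFormGroup α β).compactLie_le_lie Y) v)) 0 := by
  have hfun : (fun s : ℝ => hB.globRep p₀ q₀ hU0 hM hW htorus
      ((uFormGroup α β).expMem (s • (LieSubalgebra.inclusion (uFormGroup α β).compactLie_le_lie Y : (uFormGroup α β).lie))) (hB.emb v)) =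
      fun s : ℝ => hB.emb (ρK ((uFormGroup α β).expK (s • Y)) v) := by
    funext s
    rw [expMem_smul_inclusion_compactLie, hB.globRep_inclusion_emb p₀ q₀ hU0 hM hW htorus]
  rw [hfun]
  have h := hB.hasDerivAt_emb_expK hV Y v 0
  rwa [RealMatrixGroup.expK_zero_smul, map_one, Module.End.one_apply] at h

/-- **The differential along hermitian directions**: for `X ∈ 𝔲(α,β)` with `Xᴴ = X` (i.e. `X ∈ 𝔭`), `d/ds|₀ globRep (exp (s X)) ι v = ι (ρ(X) v)`
(`X = Ad(k)(c H₀)` by ★ S1a, `exp (sX) = k a_{sc} k⁻¹`, (U4) on `U₀`). [cite: HarishChandra1953, §9] [cite: Knapp2002, Thm. 6.51] -/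
theorem hasDerivAt_globRep_expMem_hermitian
    (hU0 : hB.U ρ K (upqUnit (p₀, q₀) (-I)) 0 = 1)
    (hM : ∀ (m : KV α β) (t : ℝ), 0 < t →
      (((kV α β m : UForm α β) : GL (α ⊕ β) ℂ) : Matrix (α ⊕ β) (α ⊕ β) ℂ) *
          ((upqUnit (p₀, q₀) (-I) : (uFormGroup α β).lie) : Matrix (α ⊕ β) (α ⊕ β) ℂ) =
        ((upqUnit (p₀, q₀) (-I) : (uFormGroup α β).lie) : Matrix (α ⊕ β) (α ⊕ β) ℂ) *
          (((kV α β m : UForm α β) : GL (α ⊕ β) ℂ) : Matrix (α ⊕ β) (α ⊕ β) ℂ) →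
      hB.kRep ρK hinv (upqMaximalCompactEquiv.symm m) ∘L hB.U ρ K (upqUnit (p₀, q₀) (-I)) t =
        hB.U ρ K (upqUnit (p₀, q₀) (-I)) t ∘L hB.kRep ρK hinv (upqMaximalCompactEquiv.symm m))
    (hW : ∀ t : ℝ, hB.kRep ρK hinv (upqMaximalCompactEquiv.symm (weylKV p₀ : KV α β)) ∘L hB.U ρ K (upqUnit (p₀, q₀) (-I)) t =
      hB.U ρ K (upqUnit (p₀, q₀) (-I)) (-t) ∘L hB.kRep ρK hinv (upqMaximalCompactEquiv.symm (weylKV p₀ : KV α β)))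
    (htorus : ∀ (g : UForm α β) (s : ℝ),
      globOp p₀ q₀ (hB.kRep ρK hinv) (hB.U ρ K (upqUnit (p₀, q₀) (-I))) (g * hypV p₀ q₀ s) =
        globOp p₀ q₀ (hB.kRep ρK hinv) (hB.U ρ K (upqUnit (p₀, q₀) (-I))) g ∘L hB.U ρ K (upqUnit (p₀, q₀) (-I)) s)
    (hV : IsGKModule (uFormGroup α β) ρK ρ) (hK : 0 < K)
    (hX : ∀ x y, B (ρ (upqUnit (p₀, q₀) (-I)) x) y = -B x (ρ (upqUnit (p₀, q₀) (-I)) y))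
    (hb : ∀ v : V, ∃ C : ℝ, ∀ n, ‖hB.emb (((ρ (upqUnit (p₀, q₀) (-I)) : V →ₗ[ℂ] V) ^ n) v)‖ ≤
      C * n ! * (K * ‖((upqUnit (p₀, q₀) (-I) : (uFormGroup α β).lie) : Matrix (α ⊕ β) (α ⊕ β) ℂ)‖) ^ n)
    (X : (uFormGroup α β).lie) (hXh : ((X : Matrix (α ⊕ β) (α ⊕ β) ℂ))ᴴ = (X : Matrix (α ⊕ β) (α ⊕ β) ℂ)) (v : V) :
    HasDerivAt (fun s : ℝ => hB.globRep p₀ q₀ hU0 hM hW htorus ((uFormGroup α β).expMem (s • X)) (hB.emb v)) (hB.emb (ρ X v)) 0 := by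
  set H₀ : (uFormGroup α β).lie := upqUnit (p₀, q₀) (-I) with hH₀
  obtain ⟨u, c, hc, hXeq⟩ := exists_Ad_smul_boostUnit_eq_of_isHermitian p₀ q₀ X hXh
  set kk : (uFormGroup α β).maximalCompact := ⟨_, upq_kV_mem_maximalCompact u (1 : Matrix.unitaryGroup β ℂ)⟩ with hkk
  set gk : (uFormGroup α β).carrier := Subgroup.inclusion (uFormGroup α β).maximalCompact_le_carrier kk with hgk
  -- `exp (sX) = gk · exp((sc) H₀) · gk⁻¹`
  have hexp : ∀ s : ℝ, (uFormGroup α β).expMem (s • X) = gk * (uFormGroup α β).expMem ((s * c) • H₀) * gk⁻¹ := by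
    intro s
    rw [hXeq, ← map_smul, smul_smul, RealMatrixGroup.expMem_Ad]
  have hkkv : ρK kk (ρK kk⁻¹ v) = v := by
    rw [← Module.End.mul_apply, ← map_mul, mul_inv_cancel, map_one, Module.End.one_apply]
  -- the representation on that product, applied to `ι v`
  have hrep : (fun s : ℝ => hB.globRep p₀ q₀ hU0 hM hW htorus ((uFormGroup α β).expMem (s • X)) (hB.emb v)) =
      fun s : ℝ => hB.kRep ρK hinv kk (hB.U ρ K H₀ (s * c) (hB.emb (ρK kk⁻¹ v))) := by
    funext s
    rw [hexp s, map_mul, map_mul, show gk⁻¹ = Subgroup.inclusion (uFormGroup α β).maximalCompact_le_carrier kk⁻¹ from (map_inv _ kk).symm,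
      hB.globRep_inclusion p₀ q₀ hU0 hM hW htorus, hB.globRep_inclusion p₀ q₀ hU0 hM hW htorus, globRep_apply, expMem_smul_boostUnit,
      globOp_hypV p₀ q₀ hU0 hM hW, ContinuousLinearMap.mul_def, ContinuousLinearMap.mul_def, ContinuousLinearMap.comp_apply,
      ContinuousLinearMap.comp_apply, hB.kRep_emb]
  rw [hrep]
  have h1 : HasDerivAt (fun s : ℝ => hB.U ρ K H₀ (s * c) (hB.emb (ρK kk⁻¹ v))) (c • hB.U ρ K H₀ (0 * c) (hB.emb (ρ H₀ (ρK kk⁻¹ v)))) 0 := by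
    have h := (hB.hasDerivAt_U_emb hK hX hb (ρK kk⁻¹ v) (0 * c)).scomp (0 : ℝ) ((hasDerivAt_id (0 : ℝ)).mul_const c)
    simpa [Function.comp_def] using h
  have h2 : HasDerivAt (fun s : ℝ => hB.kRep ρK hinv kk (hB.U ρ K H₀ (s * c) (hB.emb (ρK kk⁻¹ v))))
      (hB.kRep ρK hinv kk (c • hB.U ρ K H₀ (0 * c) (hB.emb (ρ H₀ (ρK kk⁻¹ v))))) 0 :=
    ((hB.kRep ρK hinv kk).restrictScalars ℝ).hasFDerivAt.comp_hasDerivAt (0 : ℝ) h1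
  refine h2.congr_deriv ?_
  rw [zero_mul, hU0, ContinuousLinearMap.one_def, ContinuousLinearMap.coe_id', id_eq, ContinuousLinearMap.map_smul_of_tower, hB.kRep_emb,
    rhoK_rho_apply hV kk H₀, hkkv, ← hgk]
  -- `c • ι (ρ (Ad gk H₀) v) = ι (ρ X v)`
  rw [hXeq, ← hH₀, map_smul, map_smul, LinearMap.smul_apply, LinearMap.map_smul_of_tower]

/-! ## §5 Recognition: `globRep` is a unitary globalization of `[r]` -/

omit hB in
/-- **`globRep` IS A UNITARY GLOBALIZATION of the class of the irreducible admissible `(𝔤, K)`-module `r`** (★ H `isUnitaryGlobalization_of_recognition` with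
`ι = hB.emb`, `S = 𝔨 ∪ 𝔭`).  Hypotheses: the `(𝔤, K)`-data of `r` carry a `B`-unitary∕skew structure with the factorial bound at `K`, the `globOp` hypotheses
`hU0 hM hW`, the torus translation law `htorus`, and `span (𝔨 ∪ 𝔭) = 𝔤`. [cite: KnappVogan1995, Introduction Thm. 0.6] [cite: HarishChandra1953, §9] -/
theorem isUnitaryGlobalization_globRep (r : GKIrrep (uFormGroup α β)) (hadm : IsAdmissibleGK r.ρK)
    {B : r.V →ₗ⋆[ℂ] r.V →ₗ[ℂ] ℂ} (hB : IsPosDefHerm B)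
    {hinv : ∀ (k : (uFormGroup α β).maximalCompact) (x y : r.V), B (r.ρK k x) (r.ρK k y) = B x y} {K : ℝ} (hK : 0 < K)
    (hskew : ∀ (X : (uFormGroup α β).lie) (x y : r.V), B (r.ρ𝔤 X x) y = -B x (r.ρ𝔤 X y))
    (hFB : ∀ v : r.V, ∃ C : ℝ, ∀ (m : ℕ) (X : Fin m → (uFormGroup α β).lie),
      ‖hB.emb ((List.ofFn fun i => (r.ρ𝔤 (X i) : r.V →ₗ[ℂ] r.V)).prod v)‖ ≤ C * m ! * K ^ m * ∏ i, ‖((X i : (uFormGroup α β).lie) : Matrix (α ⊕ β) (α ⊕ β) ℂ)‖)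
    (hU0 : hB.U r.ρ𝔤 K (upqUnit (p₀, q₀) (-I)) 0 = 1)
    (hM : ∀ (m : KV α β) (t : ℝ), 0 < t →
      (((kV α β m : UForm α β) : GL (α ⊕ β) ℂ) : Matrix (α ⊕ β) (α ⊕ β) ℂ) *
          ((upqUnit (p₀, q₀) (-I) : (uFormGroup α β).lie) : Matrix (α ⊕ β) (α ⊕ β) ℂ) =
        ((upqUnit (p₀, q₀) (-I) : (uFormGroup α β).lie) : Matrix (α ⊕ β) (α ⊕ β) ℂ) *
          (((kV α β m : UForm α β) : GL (α ⊕ β) ℂ) : Matrix (α ⊕ β) (α ⊕ β) ℂ) →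
      hB.kRep r.ρK hinv (upqMaximalCompactEquiv.symm m) ∘L hB.U r.ρ𝔤 K (upqUnit (p₀, q₀) (-I)) t =
        hB.U r.ρ𝔤 K (upqUnit (p₀, q₀) (-I)) t ∘L hB.kRep r.ρK hinv (upqMaximalCompactEquiv.symm m))
    (hW : ∀ t : ℝ, hB.kRep r.ρK hinv (upqMaximalCompactEquiv.symm (weylKV p₀ : KV α β)) ∘L hB.U r.ρ𝔤 K (upqUnit (p₀, q₀) (-I)) t =
      hB.U r.ρ𝔤 K (upqUnit (p₀, q₀) (-I)) (-t) ∘L hB.kRep r.ρK hinv (upqMaximalCompactEquiv.symm (weylKV p₀ : KV α β)))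
    (htorus : ∀ (g : UForm α β) (s : ℝ),
      globOp p₀ q₀ (hB.kRep r.ρK hinv) (hB.U r.ρ𝔤 K (upqUnit (p₀, q₀) (-I))) (g * hypV p₀ q₀ s) =
        globOp p₀ q₀ (hB.kRep r.ρK hinv) (hB.U r.ρ𝔤 K (upqUnit (p₀, q₀) (-I))) g ∘L hB.U r.ρ𝔤 K (upqUnit (p₀, q₀) (-I)) s)
    (hS : Submodule.span ℝ
        (Set.range (fun Y : (uFormGroup α β).compactLie => (LieSubalgebra.inclusion (uFormGroup α β).compactLie_le_lie Y : (uFormGroup α β).lie)) ∪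
          {X : (uFormGroup α β).lie | ((X : Matrix (α ⊕ β) (α ⊕ β) ℂ))ᴴ = (X : Matrix (α ⊕ β) (α ⊕ β) ℂ)}) = ⊤) :
    IsUnitaryGlobalization (uFormGroup α β) (GKIrrClass.mk r) (hB.globRep p₀ q₀ hU0 hM hW htorus) := by
  have hbH := hB.lineBound_of_FB r.ρ𝔤 hFB (upqUnit (p₀, q₀) (-I))
  have hXH := hskew (upqUnit (p₀, q₀) (-I))
  refine isUnitaryGlobalization_of_recognition (uFormGroup α β) r hadm _ (hB.isUnitary_globRep p₀ q₀ hU0 hM hW htorus hK.le hXH hbH)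
    (hB.isStronglyContinuous_globRep p₀ q₀ hU0 hM hW htorus r.isGKModule hK hXH hbH) hB.emb hB.emb_injective hB.denseRange_emb
    (fun k v => hB.globRep_inclusion_emb p₀ q₀ hU0 hM hW htorus k v) _ hS ?_
  rintro X (⟨Y, rfl⟩ | hX) v
  · exact hB.hasDerivAt_globRep_expMem_compactLie p₀ q₀ hU0 hM hW htorus r.isGKModule Y v
  · exact hB.hasDerivAt_globRep_expMem_hermitian p₀ q₀ hU0 hM hW htorus r.isGKModule hK hXH hbH X hX v

end IsPosDefHerm

end Literature.NumberTheory.Automorphic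

end
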